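import Summits.NavierStokesRegularity.FluidComputer.PalasekTowerHostLateFadeEngineBound
import Literature.Analysis.FluidPDE.OseenHeatLpBounds
import Literature.Analysis.FluidPDE.SolenoidalTruncation
import Literature.Analysis.FluidPDE.LerayHopfMildH1
import Literature.Analysis.FluidPDE.LerayHopfH1Test
import Literature.Analysis.FluidPDE.TrilinearSkew

/-!
# The Oseen pairing estimate `OseenConvectBound` HOLDS — the engine chain of the negative lane becomes unconditional

Cell `ns-blowup`, seat `ns-blowup-ecbridge-1` (g6). LABEL: E–C typing / NEGATIVE-lane engine, linear harmonic
analysis only (kernel lane). WHAT THIS IS NOT: not Navier–Stokes evidence; no statement about any registered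
stage, episode or item is made in this file.

We prove the scalar pairing estimate `Host.Engine.OseenConvectBound` of
`PalasekTowerHostLateFadeEngineBound.lean`: there is an absolute constant `C₁` (here `C₁ = 8829 = 3·327·9`)
such that for every bounded, continuous, finite-energy field `a : ℝ³ → ℝ³` with `|a| ≤ M`, every `x₀, e ∈ ℝ³`
and all `ε, s > 0`,
`|∫ ⟪a, (a·∇) P(G_{ε+s}(·-x₀) e)⟫| ≤ C₁ s^{-1/2} M² |e|`.

PROOF (all inputs are tree theorems). Let `φ = P(G_ε(·-x₀)e) = lerayHeatTest x₀ ε e` (an `H¹_σ` field,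
`LerayHeatTest.lean`), so that `e^{sΔ}φ = lerayHeatTest x₀ (ε+s) e` (`heatExtension_lerayHeatTest`). Let
`F = a ⊗ a` in the standard basis and `w = Σᵢ 𝒩_s(F)ᵢ bᵢ` the Oseen–heat field (`OseenHeat.lean`): `w ∈ L²`
(`memLp_oseenHeat`), `w` is weakly divergence free (`isWeaklyDivFree_sum_oseenHeat_smul`) and
`|w| ≤ 3 · 327 s^{-1/2} · Σⱼₖ ‖Fⱼₖ‖_∞ ≤ 8829 s^{-1/2} M²` (`enorm_oseenHeat_le_of_top`). For smooth compactly
supported divergence-free `Φ` the tree's duality identity `integral_inner_sum_oseenHeat_tensor_eq_neg` reads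
`∫⟪w, Φ⟫ = -∫⟪a, D(e^{sΔ}Φ)(a)⟫`; approximating `φ` in `H¹` by such `Φₙ` (`exists_isDivFree_test_approx`) and
passing to the limit on both sides (`L²`-pairing on the left; on the right the energy contraction
`lintegral_frobeniusNormSq_fderiv_heatExtension_sub_le` and the Hölder pairing `lintegral_enorm_inner_apply_le`
with exponents `(2, ∞)`) gives `∫⟪w, φ⟫ = -∫⟪a, (a·∇) lerayHeatTest x₀ (ε+s) e⟫`. Finally
`∫⟪w, φ⟫ = ⟪(e^{εΔ}w)(x₀), e⟫` (`integral_inner_lerayHeatTest`) is bounded by `‖w‖_∞ |e|`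
(`norm_heatExtension_le`).

CONSEQUENCE (one line each, appended to the negative-lane files by their owners): `Host.ForcedLerayShortTimeBound`
(`forcedLerayShortTimeBound_of_oseenConvectBound`, p448612) and hence `¬ FirstEpisode`
(`firstEpisode_false_of_oseenConvectBound`, `Theorems/EpisodeBase/Negative/FirstEpisodeHoldRelease.lean`) hold
unconditionally.

References: P. G. Lemarié-Rieusset, *The Navier–Stokes problem in the 21st century*, CRC 2016, Thm. 6.1
(6.11)–(6.12) and Prop. 11.1 (Oseen kernel bounds) [cite: LemarieRieusset2016, Thm. 6.1]; T. Kato, Math. Z. 187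
(1984) 471–480, (2.3') [cite: Kato1984, (2.3')]; E. B. Fabes, B. F. Jones, N. M. Rivière, Arch. Rational Mech.
Anal. 45 (1972) 222–240, Thm. 2.1 [cite: FabesJonesRiviere1972, Thm. 2.1].
-/

noncomputable section

open Set MeasureTheory Real Filter Topology
open scoped RealInnerProductSpace ENNReal NNReal

namespace Summit.NavierStokesRegularity.FluidComputer.PalasekTowerClayBridge.Host.Engine

open Literature.Analysis Literature.Analysis.FluidPDE Literature.Analysis.UnboundedOperators

/-- **The Oseen pairing estimate holds**: `|∫ ⟪a, (a·∇) P(G_{ε+s}(·-x₀) e)⟫| ≤ 8829 · s^{-1/2} M² |e|` for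
bounded continuous finite-energy `a` with `|a| ≤ M` (Oseen-tensor `L^∞` bound dualised against the caloric
Leray test field). [cite: LemarieRieusset2016, Thm. 6.1 (6.11)–(6.12)] [cite: Kato1984, (2.3')] -/
theorem oseenConvectBound_holds : OseenConvectBound := by
  refine ⟨8829, ?_⟩
  intro x₀ e ε s hε hs a ha2 hac M hM
  have hE3 : Module.finrank ℝ (EuclideanSpace ℝ (Fin 3)) = 3 := finrank_euclideanSpace_fin
  have hM0 : 0 ≤ M := (norm_nonneg _).trans (hM 0)
  have ham : AEStronglyMeasurable a volume := hac.aestronglyMeasurable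
  have ha_top : MemLp a ⊤ volume := memLp_top_of_bound ham M (ae_of_all _ hM)
  set b := stdOrthonormalBasis ℝ (EuclideanSpace ℝ (Fin 3)) with hb
  have hb1 : ∀ i, ‖b i‖ = 1 := fun i => b.orthonormal.1 i
  have hcomp : ∀ j y, ‖⟪a y, b j⟫‖ ≤ M := fun j y =>
    (norm_inner_le_norm _ _).trans (by rw [hb1, mul_one]; exact hM y)
  -- ### the tensor `a ⊗ a` in the standard basis
  set F : Fin (Module.finrank ℝ (EuclideanSpace ℝ (Fin 3))) →
      Fin (Module.finrank ℝ (EuclideanSpace ℝ (Fin 3))) → EuclideanSpace ℝ (Fin 3) → ℝ :=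
    fun j k y => ⟪a y, b j⟫ * ⟪a y, b k⟫ with hF
  have hFc : ∀ j k, Continuous (F j k) := fun j k => by
    show Continuous fun y => ⟪a y, b j⟫ * ⟪a y, b k⟫
    exact (hac.inner continuous_const).mul (hac.inner continuous_const)
  have hFbd : ∀ j k y, ‖F j k y‖ ≤ M ^ 2 := fun j k y => by
    show ‖⟪a y, b j⟫ * ⟪a y, b k⟫‖ ≤ M ^ 2
    rw [norm_mul, sq]
    exact mul_le_mul (hcomp j y) (hcomp k y) (norm_nonneg _) hM0
  have hFtop : ∀ j k, MemLp (F j k) ⊤ volume := fun j k =>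
    memLp_top_of_bound (hFc j k).aestronglyMeasurable (M ^ 2) (ae_of_all _ (hFbd j k))
  have hF2 : ∀ j k, MemLp (F j k) 2 volume := fun j k =>
    (ha2.inner_const (b k)).of_le_mul (c := M) (hFc j k).aestronglyMeasurable
      (ae_of_all _ fun y => by
        show ‖⟪a y, b j⟫ * ⟪a y, b k⟫‖ ≤ M * ‖⟪a y, b k⟫‖
        rw [norm_mul]
        exact mul_le_mul_of_nonneg_right (hcomp j y) (norm_nonneg _))
  have hFsup : ∀ j k, eLpNorm (F j k) ⊤ volume ≤ ENNReal.ofReal (M ^ 2) := fun j k => by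
    rw [eLpNorm_exponent_top]
    exact eLpNormEssSup_le_of_ae_bound (ae_of_all _ (hFbd j k))
  have hS : ∑ j, ∑ k, eLpNorm (F j k) ⊤ volume ≤ ENNReal.ofReal (9 * M ^ 2) := by
    calc ∑ j, ∑ k, eLpNorm (F j k) ⊤ volume
        ≤ ∑ _j : Fin (Module.finrank ℝ (EuclideanSpace ℝ (Fin 3))),
            ∑ _k : Fin (Module.finrank ℝ (EuclideanSpace ℝ (Fin 3))), ENNReal.ofReal (M ^ 2) :=
          Finset.sum_le_sum fun j _ => Finset.sum_le_sum fun k _ => hFsup j k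
      _ = ENNReal.ofReal (9 * M ^ 2) := by
          simp only [Finset.sum_const, Finset.card_univ, Fintype.card_fin, hE3, nsmul_eq_mul,
            Nat.cast_ofNat]
          rw [ENNReal.ofReal_mul (by norm_num), ENNReal.ofReal_ofNat]
          ring
  -- ### the Oseen–heat field `w = Σᵢ 𝒩_s(a ⊗ a)ᵢ bᵢ`
  set w : EuclideanSpace ℝ (Fin 3) → EuclideanSpace ℝ (Fin 3) :=
    fun x => ∑ i, oseenHeat s F i x • b i with hw
  have hos2 : ∀ i, MemLp (oseenHeat s F i) 2 volume := fun i =>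
    memLp_oseenHeat hE3 one_le_two le_rfl hF2 hs i
  have hw2 : MemLp w 2 volume := by
    refine memLp_finsetSum (f := fun i x => oseenHeat s F i x • b i) Finset.univ fun i _ => ?_
    exact (memLp_top_const (b i)).smul (hos2 i)
  have hwdiv : IsWeaklyDivFree w := isWeaklyDivFree_sum_oseenHeat_smul hE3 hFtop hs
  -- the sup bound `|w| ≤ 3 K`, `K = 327 s^{-1/2} · 9 M²`
  set K : ℝ := 327 * s ^ (-(1 / 2 : ℝ)) * (9 * M ^ 2) with hK
  have hK0 : 0 ≤ K := by positivity
  have hos_bd : ∀ i x, ‖oseenHeat s F i x‖ ≤ K := fun i x => by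
    have h := (enorm_oseenHeat_le_of_top hE3 hFtop hs i x).trans (mul_le_mul' le_rfl hS)
    rw [← ENNReal.ofReal_mul (by positivity), ← ofReal_norm] at h
    exact (ENNReal.ofReal_le_ofReal_iff hK0).1 h
  have hwbd : ∀ x, ‖w x‖ ≤ 3 * K := fun x => by
    calc ‖w x‖ ≤ ∑ i, ‖oseenHeat s F i x • b i‖ := norm_sum_le _ _
      _ ≤ ∑ _i : Fin (Module.finrank ℝ (EuclideanSpace ℝ (Fin 3))), K :=
          Finset.sum_le_sum fun i _ => by rw [norm_smul, hb1, mul_one]; exact hos_bd i x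
      _ = 3 * K := by
          simp only [Finset.sum_const, Finset.card_univ, Fintype.card_fin, hE3, nsmul_eq_mul,
            Nat.cast_ofNat]
  -- ### the test field `φ = P(G_ε(·-x₀) e)` and the value of the pairing `∫⟪w, φ⟫`
  have hφ2 : MemLp (lerayHeatTest x₀ ε e) 2 volume := memLp_two_lerayHeatTest hε
  have hφdiv : IsWeaklyDivFree (lerayHeatTest x₀ ε e) := isWeaklyDivFree_lerayHeatTest hε
  have hφG := hasWeakGradient_lerayHeatTest (x₀ := x₀) (e := e) hε
  have hG2 := lintegral_frobeniusNormSq_fderiv_lerayHeatTest_lt_top (x₀ := x₀) (e := e) hε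
  have hext : heatExtension (lerayHeatTest x₀ ε e) s = lerayHeatTest x₀ (ε + s) e :=
    funext fun x => heatExtension_lerayHeatTest hε hs x
  have hIbd : ‖∫ x, ⟪w x, lerayHeatTest x₀ ε e x⟫‖ ≤ 3 * K * ‖e‖ := by
    rw [integral_inner_lerayHeatTest hε hw2 hwdiv]
    exact (norm_inner_le_norm _ _).trans
      (mul_le_mul_of_nonneg_right (norm_heatExtension_le hwbd hε x₀) (norm_nonneg _))
  -- ### divergence-free test approximants of `φ` and the duality identity for each of them
  set δ : ℕ → ℝ≥0∞ := fun n => ENNReal.ofReal (1 / ((n : ℝ) + 1)) with hδ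
  have hδpos : ∀ n, 0 < δ n := fun n => ENNReal.ofReal_pos.2 (by positivity)
  have hδ0 : Tendsto δ atTop (𝓝 0) := by
    have h := ENNReal.tendsto_ofReal (tendsto_one_div_add_atTop_nhds_zero_nat)
    rwa [ENNReal.ofReal_zero] at h
  have hex : ∀ n : ℕ, ∃ Φ : EuclideanSpace ℝ (Fin 3) → EuclideanSpace ℝ (Fin 3),
      FunctionSpaces.IsTestFunctionOn (⊤ : TopologicalSpace.Opens (EuclideanSpace ℝ (Fin 3))) Φ ∧
      VectorCalculus.IsDivFree Φ ∧ eLpNorm (Φ - lerayHeatTest x₀ ε e) 2 volume ≤ δ n ∧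
      ∫⁻ x, ENNReal.ofReal (frobeniusNormSq
        (fderiv ℝ Φ x - fderiv ℝ (lerayHeatTest x₀ ε e) x)) ≤ δ n := fun n =>
    exists_isDivFree_test_approx hE3 hφ2 hφdiv hφG hG2 (hδpos n)
  choose Φ hΦt hΦdiv hΦL2 hΦD using hex
  have hΦ2 : ∀ n, MemLp (Φ n) 2 volume := fun n => (hΦt n).memLp_volume 2
  have hint : ∀ n i, Integrable (fun x => oseenHeat s F i x * ⟪Φ n x, b i⟫) volume := fun n i =>
    (hos2 i).integrable_mul ((hΦ2 n).inner_const (b i))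
  have hdual : ∀ n, ∫ x, ⟪w x, Φ n x⟫ =
      -∫ y, ⟪a y, fderiv ℝ (heatExtension (Φ n) s) y (a y)⟫ := fun n =>
    integral_inner_sum_oseenHeat_tensor_eq_neg (p := 2) (q := 2) (u := a) (v := a) hE3 hF2 hs
      (hΦt n) (hΦdiv n) (hint n)
  -- ### (a) the left-hand sides converge: `∫⟪w, Φₙ⟫ → ∫⟪w, φ⟫`
  have hlimL : Tendsto (fun n => ∫ x, ⟪w x, Φ n x⟫) atTop
      (𝓝 (∫ x, ⟪w x, lerayHeatTest x₀ ε e x⟫)) := by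
    refine tendsto_of_enorm_sub_le (e := fun n => eLpNorm w 2 volume * δ n) (fun n => ?_) ?_
    · have hsub : (∫ x, ⟪w x, Φ n x⟫) - ∫ x, ⟪w x, lerayHeatTest x₀ ε e x⟫ =
          ∫ x, ⟪w x, Φ n x - lerayHeatTest x₀ ε e x⟫ := by
        rw [← integral_sub (FunctionSpaces.integrable_inner_of_eLpNorm_two_lt_top hw2.1 (hΦ2 n).1
          hw2.2 (hΦ2 n).2) (FunctionSpaces.integrable_inner_of_eLpNorm_two_lt_top hw2.1 hφ2.1
          hw2.2 hφ2.2)]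
        exact integral_congr_ae (Eventually.of_forall fun x => (inner_sub_right _ _ _).symm)
      rw [hsub]
      exact (FunctionSpaces.enorm_integral_inner_le_eLpNorm_mul hw2.1 ((hΦ2 n).1.sub hφ2.1)).trans
        (mul_le_mul' le_rfl (hΦL2 n))
    · have h := ENNReal.Tendsto.const_mul hδ0 (Or.inr hw2.eLpNorm_ne_top)
      rwa [mul_zero] at h
  -- ### (b) the right-hand sides converge (energy contraction of the heat flow + Hölder `(2, ∞)`)
  set A : ℕ → EuclideanSpace ℝ (Fin 3) → EuclideanSpace ℝ (Fin 3) →L[ℝ] EuclideanSpace ℝ (Fin 3) :=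
    fun n x => fderiv ℝ (heatExtension (Φ n) s) x with hA
  set Aφ : EuclideanSpace ℝ (Fin 3) → EuclideanSpace ℝ (Fin 3) →L[ℝ] EuclideanSpace ℝ (Fin 3) :=
    fun x => fderiv ℝ (heatExtension (lerayHeatTest x₀ ε e) s) x with hAφ
  have hAm : ∀ n, AEStronglyMeasurable (A n) volume := fun n =>
    (continuous_fderiv_heatExtension_of_memLp (hΦ2 n) one_le_two hs).aestronglyMeasurable
  have hAφm : AEStronglyMeasurable Aφ volume :=
    (continuous_fderiv_heatExtension_of_memLp hφ2 one_le_two hs).aestronglyMeasurable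
  have hAφD : ∫⁻ x, ENNReal.ofReal (frobeniusNormSq (Aφ x)) ≤
      ∫⁻ x, ENNReal.ofReal (frobeniusNormSq (fderiv ℝ (lerayHeatTest x₀ ε e) x)) := by
    have h := lintegral_frobeniusNormSq_fderiv_heatExtension_sub_le
      (FunctionSpaces.isTestFunctionOn_zero (⊤ : TopologicalSpace.Opens (EuclideanSpace ℝ (Fin 3))))
      hφG hφ2 hG2 hs
    have h0 : ∀ r : ℝ, heatExtension (0 : EuclideanSpace ℝ (Fin 3) → EuclideanSpace ℝ (Fin 3)) r = 0 :=
      fun r => by funext x; simp [heatExtension_apply]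
    simp only [h0, fderiv_zero, Pi.zero_apply, zero_sub] at h
    have hneg : ∀ L : EuclideanSpace ℝ (Fin 3) →L[ℝ] EuclideanSpace ℝ (Fin 3),
        frobeniusNormSq (-L) = frobeniusNormSq L := fun L => by
      rw [← zero_sub, frobeniusNormSq_sub_comm, sub_zero]
    simpa only [hneg] using h
  have hAφ2 : ∫⁻ x, ENNReal.ofReal (frobeniusNormSq (Aφ x)) < ⊤ := hAφD.trans_lt hG2
  have hAD : ∀ n, ∫⁻ x, ENNReal.ofReal (frobeniusNormSq (A n x - Aφ x)) ≤ δ n := fun n =>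
    (lintegral_frobeniusNormSq_fderiv_heatExtension_sub_le (hΦt n) hφG hφ2 hG2 hs).trans (hΦD n)
  have hA12 : ∀ n, ∫⁻ x, ENNReal.ofReal (frobeniusNormSq (A n x - Aφ x)) < ⊤ := fun n =>
    (hAD n).trans_lt ENNReal.ofReal_lt_top
  have hA12m : ∀ n, AEStronglyMeasurable (fun x => A n x - Aφ x) volume := fun n =>
    (hAm n).sub hAφm
  have iφ : Integrable (fun x => ⟪a x, Aφ x (a x)⟫) :=
    (integrable_inner_apply_of_holder hAφm hAφ2 ha2 ha_top).congr
      (ae_of_all _ fun x => real_inner_comm _ _)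
  have i12 : ∀ n, Integrable (fun x => ⟪a x, (A n x - Aφ x) (a x)⟫) := fun n =>
    (integrable_inner_apply_of_holder (hA12m n) (hA12 n) ha2 ha_top).congr
      (ae_of_all _ fun x => real_inner_comm _ _)
  set c : ℕ → ℝ := fun n => ∫ y, ⟪a y, A n y (a y)⟫ with hc
  set cφ : ℝ := ∫ y, ⟪a y, Aφ y (a y)⟫ with hcφ
  have hcn : ∀ n, c n - cφ = ∫ x, ⟪a x, (A n x - Aφ x) (a x)⟫ := by
    intro n
    have h1 : c n = (∫ x, ⟪a x, (A n x - Aφ x) (a x)⟫) + cφ := by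
      simp only [hc, hcφ]
      rw [← integral_add (i12 n) iφ]
      refine integral_congr_ae (ae_of_all _ fun x => ?_)
      dsimp only
      rw [← inner_add_right, _root_.sub_apply, sub_add_cancel]
    rw [h1, add_sub_cancel_right]
  have hlimR : Tendsto c atTop (𝓝 cφ) := by
    refine tendsto_of_enorm_sub_le
      (e := fun n => δ n ^ (1 / 2 : ℝ) * (eLpNorm a 2 volume * eLpNorm a ⊤ volume)) (fun n => ?_) ?_
    · rw [hcn n]
      refine (enorm_integral_le_lintegral_enorm _).trans ?_
      calc ∫⁻ x, ‖⟪a x, (A n x - Aφ x) (a x)⟫‖ₑ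
          = ∫⁻ x, ‖⟪(A n x - Aφ x) (a x), a x⟫‖ₑ :=
            lintegral_congr fun x => by rw [real_inner_comm]
        _ ≤ (∫⁻ x, ENNReal.ofReal (frobeniusNormSq (A n x - Aφ x))) ^ (1 / 2 : ℝ) *
              (eLpNorm a 2 volume * eLpNorm a ⊤ volume) :=
            lintegral_enorm_inner_apply_le (hA12m n) ham ham 2 ⊤
        _ ≤ δ n ^ (1 / 2 : ℝ) * (eLpNorm a 2 volume * eLpNorm a ⊤ volume) := by
            gcongr
            exact hAD n
    · have hδhalf : Tendsto (fun n => δ n ^ (1 / 2 : ℝ)) atTop (𝓝 0) := by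
        have h := hδ0.ennrpow_const (1 / 2 : ℝ)
        rwa [ENNReal.zero_rpow_of_pos (by norm_num)] at h
      have h := ENNReal.Tendsto.mul_const hδhalf
        (Or.inr (ENNReal.mul_ne_top ha2.eLpNorm_ne_top ha_top.eLpNorm_ne_top))
      rwa [zero_mul] at h
  -- ### the identity for `φ` itself and the conclusion
  have hfun : ∀ n, ∫ x, ⟪w x, Φ n x⟫ = -c n := fun n => by
    simp only [hc, hA]
    exact hdual n
  have hlimL' : Tendsto (fun n => ∫ x, ⟪w x, Φ n x⟫) atTop (𝓝 (-cφ)) := by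
    simp only [hfun]
    exact hlimR.neg
  have hI : ∫ x, ⟪w x, lerayHeatTest x₀ ε e x⟫ = -cφ := tendsto_nhds_unique hlimL hlimL'
  have hJ : ∫ x, ⟪a x, convect a (lerayHeatTest x₀ (ε + s) e) x⟫ = cφ := by
    simp only [hcφ, hAφ, convect_apply, hext]
  rw [hJ, show cφ = -∫ x, ⟪w x, lerayHeatTest x₀ ε e x⟫ by rw [hI, neg_neg], enorm_neg,
    ← ofReal_norm]
  calc ENNReal.ofReal ‖∫ x, ⟪w x, lerayHeatTest x₀ ε e x⟫‖
      ≤ ENNReal.ofReal (3 * K * ‖e‖) := ENNReal.ofReal_le_ofReal hIbd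
    _ = ENNReal.ofReal ((8829 * s ^ (-(1 / 2 : ℝ)) * M ^ 2) * ‖e‖) := by
        congr 1
        simp only [hK]
        ring
    _ = ((8829 : ℝ≥0) : ℝ≥0∞) * ENNReal.ofReal (s ^ (-(1 / 2 : ℝ))) * ENNReal.ofReal (M ^ 2) * ‖e‖ₑ := by
        rw [ENNReal.ofReal_mul (by positivity), ENNReal.ofReal_mul (by positivity),
          ENNReal.ofReal_mul (by norm_num), ENNReal.ofReal_ofNat, ofReal_norm]
        rfl

/-- **The forced short-time sup bound holds** (unconditional): the engine hypothesis
`Host.ForcedLerayShortTimeBound` of the negative lane (`PalasekTowerHostLateFade.lean`) follows from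
`oseenConvectBound_holds` by the assembly `forcedLerayShortTimeBound_of_oseenConvectBound`
(`PalasekTowerHostLateFadeEngineBound.lean`). [cite: Tao2011, Prop. 9.1 (proof, (9.2))]
[cite: LemarieRieusset2016, Thm. 6.1] -/
theorem forcedLerayShortTimeBound_holds : ForcedLerayShortTimeBound :=
  forcedLerayShortTimeBound_of_oseenConvectBound oseenConvectBound_holds

end Summit.NavierStokesRegularity.FluidComputer.PalasekTowerClayBridge.Host.Engine

end
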